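import Literature.IUT.LogVolume.DyadicPrimeResidueIsometryStable
import Literature.IUT.LogVolume.IsometryEmbeddingOrder
import HarnessLib

/-!
# The residual dyadic class: every isometry is an INTEGRAL EMBEDDING-ORDER element — hence `(R_I)^∼` is fixed in EVERY packet shape

Classical local algebra (nothing disputed).  abc-iut cell, block E, lane-2 adversary sketch (abc-iut-E-cx-2 gen 3) for the R-J row Y-29b
«n-slot» precision rider: `DyadicPrimeResidueIsometryStable` (two slots, `K ⊗ K`) decomposes an isometry `σ` of a field `K/ℚ_p` on the
residual class (units `≡ 1`, uniformizer `π`, some `‖x₀‖ ≤ ‖π‖⁻¹` with `‖Tr x₀‖ ≥ 1`) as `σ = 1 + Σ_j Tr(t_j ·)·u_j` with `‖u_j‖·‖t_j‖ ≤ 1`.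
Expanding `Tr = Σ_τ τ` in `ℚ̄_p` shows that `ι ∘ σ = Σ_τ c_τ·τ` over the embeddings `τ : K → ℚ̄_p` with `‖c_τ‖ ≤ 1` — verbatim the
hypothesis of abc-iut-E-t42's `EmbeddingOrder.congr_image_normalizedPacket_of_embeddingOrder` (ANY index type, any packet shape).  So the
two-slot stability extends to every number of slots with no relative-trace bookkeeping; and MIXED packets whose slots are each either TAME
(`Tr(𝒪) = ℤ_p`, E-t42) or on the residual dyadic class are stable as well (`congr_image_normalizedPacket_eq_of_tame_or_primeResidue`, v2).
Proof-only; 0 definitions; no `sorry`.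
[cite: SerreLocalFields1979, Ch. III §3, Prop. 7] [cite: NeukirchANT1999, Ch. II (4.8)] [cite: Mochizuki2012, IUTchIV Prop. 1.1 p. 9]
-/

noncomputable section

open Module

namespace Literature.IUT.LogVolume

namespace DyadicPrimeResidue

variable {p : ℕ} [Fact p.Prime]
variable {K : Type} [NontriviallyNormedField K] [NormedAlgebra ℚ_[p] K] [IsUltrametricDist K] [ProperSpace K]

/-- **On the residual class every `ℚ_p`-linear isometry lies in the integral EMBEDDING order**: for every embedding `ι : K → ℚ̄_p`,
`ι ∘ σ = Σ_τ c_τ·τ` over embeddings `τ : K → ℚ̄_p` with `‖c_τ‖ ≤ 1` (`c_τ = [τ = ι] + Σ_j ι(σ b_j − b_j)·τ(t_j)` along a norm-dominated basis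
`b` with trace-dual family `t`, `‖σ b_j − b_j‖·‖t_j‖ ≤ 1` by `norm_mul_le_one_of_strict`). [cite: SerreLocalFields1979, Ch. III §3, Prop. 7] -/
theorem exists_embeddingOrder_repr_of_isometry (hres : ∀ w : K, ‖w‖ = 1 → ‖w - 1‖ < 1)
    (π : K) (hπmax : ∀ y : K, ‖y‖ < 1 → ‖y‖ ≤ ‖π‖) (x₀ : K) (hx₀ : ‖x₀‖ ≤ ‖π‖⁻¹) (htr₀ : 1 ≤ ‖Algebra.trace ℚ_[p] K x₀‖)
    (σ : K ≃ₗ[ℚ_[p]] K) (hσ : ∀ x, ‖σ x‖ = ‖x‖) (ι : K →ₐ[ℚ_[p]] PadicAlgCl p) :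
    ∃ (T : Finset (K →ₐ[ℚ_[p]] PadicAlgCl p)) (c : (K →ₐ[ℚ_[p]] PadicAlgCl p) → PadicAlgCl p),
      (∀ τ ∈ T, ‖c τ‖ ≤ 1) ∧ ∀ x, ι (σ x) = ∑ τ ∈ T, c τ * τ x := by
  classical
  haveI := finiteDimensional p K
  obtain ⟨b, hb⟩ := TameDualPair.exists_dominated_basis (p := p) (E := K)
  have ht' : ∀ j : Fin (finrank ℚ_[p] K), ∃ t : K, ∀ x, Algebra.trace ℚ_[p] K (t * x) = b.coord j x :=
    fun j => exists_trace_mul_eq (b.coord j)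
  choose t ht using ht'
  -- each piece of `σ − 1` is strictly contracting, hence `‖u_j‖·‖t_j‖ ≤ 1`
  have hut : ∀ j, ‖σ (b j) - b j‖ * ‖t j‖ ≤ 1 := by
    intro j
    refine norm_mul_le_one_of_strict π hπmax x₀ hx₀ htr₀ fun x hx => ?_
    rw [ht j x, Basis.coord_apply]
    by_cases hc : b.repr x j = 0
    · rw [hc, norm_zero, zero_mul]; exact norm_pos_iff.mpr hx
    have hlt : ‖σ (b j) - b j‖ < ‖b j‖ := norm_sub_lt_of_isometry hres σ hσ (b.ne_zero j)
    calc ‖b.repr x j‖ * ‖σ (b j) - b j‖ < ‖b.repr x j‖ * ‖b j‖ := mul_lt_mul_of_pos_left hlt (norm_pos_iff.mpr hc)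
      _ = ‖b.repr x j • b j‖ := (norm_smul _ _).symm
      _ ≤ ‖x‖ := hb x j
  -- `σ x = x + Σ_j Tr(t_j x) • (σ b_j − b_j)`
  have hdecomp : ∀ x : K, σ x = x + ∑ j, Algebra.trace ℚ_[p] K (t j * x) • (σ (b j) - b j) := by
    intro x
    simp_rw [ht, Basis.coord_apply, smul_sub, Finset.sum_sub_distrib, ← map_smul, ← map_sum, b.sum_repr x]
    abel
  refine ⟨Finset.univ, fun τ => (if τ = ι then 1 else 0) + ∑ j, ι (σ (b j) - b j) * τ (t j), fun τ _ => ?_, fun x => ?_⟩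
  · refine (IsUltrametricDist.norm_add_le_max _ _).trans (max_le ?_ ?_)
    · split_ifs <;> simp
    · refine IsUltrametricDist.norm_sum_le_of_forall_le_of_nonneg zero_le_one fun j _ => ?_
      rw [norm_mul, norm_map_algHom ι, norm_map_algHom τ]
      exact hut j
  · have hsplit : ∑ τ : K →ₐ[ℚ_[p]] PadicAlgCl p,
        ((if τ = ι then (1 : PadicAlgCl p) else 0) + ∑ j, ι (σ (b j) - b j) * τ (t j)) * τ x =
        ι x + ∑ τ : K →ₐ[ℚ_[p]] PadicAlgCl p, (∑ j, ι (σ (b j) - b j) * τ (t j)) * τ x := by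
      simp_rw [add_mul, Finset.sum_add_distrib, ite_mul, one_mul, zero_mul, Finset.sum_ite_eq', Finset.mem_univ, if_true]
    rw [hsplit, hdecomp x, map_add, map_sum]
    congr 1
    calc ∑ j, ι (Algebra.trace ℚ_[p] K (t j * x) • (σ (b j) - b j))
        = ∑ j, ι (σ (b j) - b j) * algebraMap ℚ_[p] (PadicAlgCl p) (Algebra.trace ℚ_[p] K (t j * x)) :=
          Finset.sum_congr rfl fun j _ => by rw [map_smul, Algebra.smul_def, mul_comm]
      _ = ∑ j, ι (σ (b j) - b j) * ∑ τ : K →ₐ[ℚ_[p]] PadicAlgCl p, τ (t j * x) := by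
          simp_rw [trace_eq_sum_embeddings (PadicAlgCl p)]
      _ = ∑ τ : K →ₐ[ℚ_[p]] PadicAlgCl p, (∑ j, ι (σ (b j) - b j) * τ (t j)) * τ x := by
          simp_rw [Finset.mul_sum, Finset.sum_mul]
          rw [Finset.sum_comm]
          exact Finset.sum_congr rfl fun τ _ => Finset.sum_congr rfl fun j _ => by rw [map_mul]; ring

/-- **`(⊗_i f_i)((R_I)^∼) = (R_I)^∼` in EVERY packet shape `⊗_{i ∈ I} K` on the residual class** (`I` any finite non-empty index type,
`f_i` any `ℚ_p`-linear isometries of `K`): the two-slot theorem `congr_mem_normalizedPacket_of_isometry` for every number of slots, through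
abc-iut-E-t42's embedding-order criterion. [cite: Mochizuki2012, IUTchIV Prop. 1.1 p. 9] [cite: SerreLocalFields1979, Ch. III §3, Prop. 7] -/
theorem congr_image_normalizedPacket_eq_of_isometries {I : Type} [Fintype I] [DecidableEq I] [Nonempty I]
    (hres : ∀ w : K, ‖w‖ = 1 → ‖w - 1‖ < 1)
    (π : K) (hπmax : ∀ y : K, ‖y‖ < 1 → ‖y‖ ≤ ‖π‖) (x₀ : K) (hx₀ : ‖x₀‖ ≤ ‖π‖⁻¹) (htr₀ : 1 ≤ ‖Algebra.trace ℚ_[p] K x₀‖)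
    (f : I → (K ≃ₗ[ℚ_[p]] K)) (hf : ∀ i x, ‖f i x‖ = ‖x‖) :
    (PiTensorProduct.congr f : PacketAlgebra p (fun _ : I => K) ≃ₗ[ℚ_[p]] PacketAlgebra p (fun _ : I => K)) ''
        (normalizedPacket p (fun _ : I => K) : Set (PacketAlgebra p (fun _ : I => K))) = normalizedPacket p (fun _ : I => K) := by
  obtain ⟨ι⟩ := EmbeddingOrder.nonempty_algHom_padicAlgCl (p := p) (K := K)
  have hf' : ∀ i x, ‖(f i).symm x‖ = ‖x‖ := fun i x => by
    conv_rhs => rw [← (f i).apply_symm_apply x]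
    rw [hf]
  exact EmbeddingOrder.congr_image_normalizedPacket_of_embeddingOrder p (fun _ : I => K) f
    (fun i => ⟨ι, exists_embeddingOrder_repr_of_isometry hres π hπmax x₀ hx₀ htr₀ (f i) (hf i) ι⟩)
    (fun i => ⟨ι, exists_embeddingOrder_repr_of_isometry hres π hπmax x₀ hx₀ htr₀ (f i).symm (hf' i) ι⟩)

/-- … and NO isometric mover of `(R_I)^∼` exists in any packet shape on the residual class (the `n`-slot form of
`not_exists_isometry_mover`). [cite: Mochizuki2012, IUTchIV Prop. 1.1 p. 9] -/
theorem not_exists_isometry_mover_slots {I : Type} [Fintype I] [DecidableEq I] [Nonempty I]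
    (hres : ∀ w : K, ‖w‖ = 1 → ‖w - 1‖ < 1)
    (π : K) (hπmax : ∀ y : K, ‖y‖ < 1 → ‖y‖ ≤ ‖π‖) (x₀ : K) (hx₀ : ‖x₀‖ ≤ ‖π‖⁻¹) (htr₀ : 1 ≤ ‖Algebra.trace ℚ_[p] K x₀‖) :
    ¬ ∃ (f : I → (K ≃ₗ[ℚ_[p]] K)) (_ : ∀ i x, ‖f i x‖ = ‖x‖) (z : PacketAlgebra p (fun _ : I => K)),
        z ∈ normalizedPacket p (fun _ : I => K) ∧
        (PiTensorProduct.congr f : PacketAlgebra p (fun _ : I => K) ≃ₗ[ℚ_[p]] PacketAlgebra p (fun _ : I => K)) z ∉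
          normalizedPacket p (fun _ : I => K) := by
  rintro ⟨f, hf, z, hz, hmove⟩
  have himg := congr_image_normalizedPacket_eq_of_isometries hres π hπmax x₀ hx₀ htr₀ f hf
  have hmem : (PiTensorProduct.congr f : PacketAlgebra p (fun _ : I => K) ≃ₗ[ℚ_[p]] PacketAlgebra p (fun _ : I => K)) z ∈
      (PiTensorProduct.congr f : PacketAlgebra p (fun _ : I => K) ≃ₗ[ℚ_[p]] PacketAlgebra p (fun _ : I => K)) ''
        (normalizedPacket p (fun _ : I => K) : Set (PacketAlgebra p (fun _ : I => K))) := Set.mem_image_of_mem _ hz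
  rw [himg] at hmem
  exact hmove hmem

/-- **MIXED packets, any shape**: for slot fields `k_i` (`i ∈ I`, any finite non-empty `I`) EACH of which is either TAME — `Tr(𝒪_{k_i}) = ℤ_p`,
i.e. `¬ ∀ x, ‖x‖ ≤ 1 → ‖Tr x‖ < 1` (abc-iut-E-t42's `exists_embeddingOrder_repr_of_isometry_of_not_wild`) — or on the RESIDUAL DYADIC CLASS
(units `≡ 1`, a uniformizer `π_i`, some `‖x₀‖ ≤ ‖π_i‖⁻¹` with `‖Tr x₀‖ ≥ 1`; `exists_embeddingOrder_repr_of_isometry` above), every tuple of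
factorwise `ℚ_p`-linear isometries satisfies `(⊗_i g_i)((R_I)^∼) = (R_I)^∼` — slot by slot into E-t42's criterion.  (The residual alternative
is vacuous at odd `p`: `w = −1` has `‖w − 1‖ = ‖2‖ = 1`.) [cite: Mochizuki2012, IUTchIV Prop. 1.1 p. 9] [cite: SerreLocalFields1979, Ch. III §3, Prop. 7] -/
theorem congr_image_normalizedPacket_eq_of_tame_or_primeResidue {I : Type} [Fintype I] [DecidableEq I] [Nonempty I]
    (k : I → Type) [∀ i, NontriviallyNormedField (k i)] [∀ i, NormedAlgebra ℚ_[p] (k i)] [∀ i, IsUltrametricDist (k i)]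
    [∀ i, ProperSpace (k i)]
    (hslot : ∀ i, (¬ ∀ x : k i, ‖x‖ ≤ 1 → ‖Algebra.trace ℚ_[p] (k i) x‖ < 1) ∨
      ((∀ w : k i, ‖w‖ = 1 → ‖w - 1‖ < 1) ∧ ∃ π x₀ : k i, (∀ y : k i, ‖y‖ < 1 → ‖y‖ ≤ ‖π‖) ∧ ‖x₀‖ ≤ ‖π‖⁻¹ ∧
        1 ≤ ‖Algebra.trace ℚ_[p] (k i) x₀‖))
    (g : ∀ i, k i ≃ₗ[ℚ_[p]] k i) (hg : ∀ i x, ‖g i x‖ = ‖x‖) :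
    (PiTensorProduct.congr g : PacketAlgebra p k ≃ₗ[ℚ_[p]] PacketAlgebra p k) ''
        (normalizedPacket p k : Set (PacketAlgebra p k)) = normalizedPacket p k := by
  have hg' : ∀ i x, ‖(g i).symm x‖ = ‖x‖ := fun i x => by
    conv_rhs => rw [← (g i).apply_symm_apply x]
    rw [hg]
  have key : ∀ (i : I) (σ : k i ≃ₗ[ℚ_[p]] k i), (∀ x, ‖σ x‖ = ‖x‖) →
      ∃ (ι : k i →ₐ[ℚ_[p]] PadicAlgCl p) (T : Finset (k i →ₐ[ℚ_[p]] PadicAlgCl p))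
        (c : (k i →ₐ[ℚ_[p]] PadicAlgCl p) → PadicAlgCl p), (∀ τ ∈ T, ‖c τ‖ ≤ 1) ∧ ∀ x, ι (σ x) = ∑ τ ∈ T, c τ * τ x := by
    intro i σ hσ
    obtain ⟨ι⟩ := EmbeddingOrder.nonempty_algHom_padicAlgCl (p := p) (K := k i)
    rcases hslot i with htame | ⟨hres, π, x₀, hπmax, hx₀, htr₀⟩
    · exact ⟨ι, (EmbeddingOrder.exists_embeddingOrder_repr_of_isometry_of_not_wild htame σ hσ ι).1⟩
    · exact ⟨ι, exists_embeddingOrder_repr_of_isometry hres π hπmax x₀ hx₀ htr₀ σ hσ ι⟩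
  exact EmbeddingOrder.congr_image_normalizedPacket_of_embeddingOrder p k g (fun i => key i (g i) (hg i))
    (fun i => key i (g i).symm (hg' i))

end DyadicPrimeResidue

end Literature.IUT.LogVolume

end
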